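import Literature.NumberTheory.EllipticCurves.PastenValuationProduct
import Literature.NumberTheory.EllipticCurves.ModularDegreeMinimal
import Literature.NumberTheory.EllipticCurves.ModularDegreeFormulaProofs
import Literature.NumberTheory.EllipticCurves.SilvermanHeightLogDiscriminant
import Literature.NumberTheory.EllipticCurves.NewformPeterssonSize
import Literature.NumberTheory.EllipticCurves.NewformPeterssonSizeProofs
import Literature.NumberTheory.EllipticCurves.SilvermanHeightLogDiscriminantProofs
import Literature.NumberTheory.EllipticCurves.PastenSpectralDegree
import Literature.NumberTheory.EllipticCurves.GlobalMinimalModelProofs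
import Literature.NumberTheory.EllipticCurves.SzpiroOfAbcProofs
import Literature.NumberTheory.DiophantineGeometry.EllArithGlueProofs
import HarnessLib

/-!
# Pasten, *Shimura curves and the abc conjecture*, Thm 7.5 — the classical modular approach,
# assembled from its printed inputs

Topic `NumberTheory/EllipticCurves`; namespace `Literature.NumberTheory.EllipticCurves` (helpers in
the sub-namespace `….Pasten2024`). One of the per-result proofs siblings of
`Literature/NumberTheory/EllipticCurves/PastenValuationProduct.lean` (see the index
`PastenValuationProductProofs.lean`), towards the named fact `pasten_thm_7_5` there (`log|Δ_E| < (1/4 + ε) N_E log N_E` for `N_E ≫_ε 1`;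
H. Pasten, J. Number Theory 254 (2024) = arXiv:1705.09251, Thm 7.5, p. 27 of the arXiv version).
Theorems only: NO definition and NO new named fact is introduced here (D-0026).

## The printed proof (arXiv:1705.09251, §3 p. 13 and §7.4 p. 27) and this file

Pasten proves the discriminant clause of Thm 7.5 by chaining
* (3.1) `log Δ_E ≤ 12 h(E) + 16` ("by a formula of Silverman") — in the tree the named fact
  `ModularForms.pasten2024_log_minimalDiscriminant_le` (`SilvermanHeightLogDiscriminant.lean`,
  with `h(E) = neronLatticeHeight Λ_Néron = −½ log covol(Λ_Néron)`, Silverman 1986 (14));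
* (EqFrey) `log δ_{1,N} = 2 log(2π c_f) + 2 log ‖f‖ + 2 h(A_{1,N})` (Frey) — in the tree this is
  Zagier's identity `4π² c² (f,f) = deg φ · covol(Λ_E)`, PROVED for every modular parametrisation
  datum (`ModularParametrizationData.zagier_degree_formula_holds`), read through
  `h = −½ log covol`; the datum parametrises `E` itself, so Pasten's passage through the optimal
  quotient `A_{1,N}` and `|h(A_{1,N}) − h(E)| < 3` (Mazur–Kenku, Faltings) is not needed here;
* the "trivial" lower bound `log(2π c_f) + log ‖f‖ > −6` (`c_f ∈ ℤ ∖ {0}`; integrate `f f̄` over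
  `|x| < ½, y > 1`) — here: `c ≠ 0` is the tree's PROVED `maninConstant_ne_zero_holds`, and a
  lower bound `(f,f) ≥ c₀ > 0` uniform in the level is taken from the named fact
  `ModularForms.murty_petersson_newform_lower_bound` (Murty 1999 / Hoffstein–Lockhart, quoted by
  Pasten right after (EqFrey); any `N`-uniform constant suffices for Thm 7.5);
* hence (3.2) `h(E) ≤ ½ log δ_{1,N} + 9`, and so `log Δ_E ≤ 6 log δ_{1,N} + 124`
  (`exists_log_minimalDiscriminantNorm_le`: `log|Δ_min| ≤ 6 log(deg) + K`, `K` absolute);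
* Thm 7.2 (asymptotic): `log δ_{1,N} < (1/24 + ε) N log N` for `N ≫_ε 1` — NOT in the tree
  (neither as a theorem nor as a named fact: see the module docstring of
  `HeckeCongruenceModulus.lean`, "named facts belong to the cite item for Pasten Thm 5.5 / 7.2");
  it enters `pasten_thm_7_5_of_classicalModularApproach` as an explicit hypothesis `hdeg`,
  rendered on the tree's minimal modular degree `minModularDegree W N_W` of a globally minimal
  model (`ModularDegreeMinimal.lean`; for the printed `δ_{1,N}` of the optimal quotient one has
  `minModularDegree ≤ 163 · δ_{1,N}` by Mazur–Kenku, absorbed in `ε` for `N ≫ 1`);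
* modularity with an integral Manin constant (Wiles, Taylor–Wiles, BCDT; Edixhoven) — the named
  fact `ModularForms.nonempty_modularParametrizationData` (`ModularCurve.lean`);
* §7.4: `log Δ_E ≤ 12(½(1/24 + ε) N log N + 9) + 16 = (1/4 + 6ε) N log N + 124 < (1/4 + 7ε) N log N`
  for `N ≫_ε 1` (`pasten_thm_7_5_of_classicalModularApproach`).
The passage from an arbitrary model `W` to a global minimal model `C • W` (Néron; the tree's PROVED
`hasGlobalMinimalModel_rat_holds`) uses the PROVED invariances `conductorNorm_smul_rat`,
`minimalDiscriminantNorm_smul_rat` and `|Δ_min| = |Δ(W₀)|`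
(`minimalDiscriminantNorm_int_eq_natAbs_minimalDiscriminantInt_holds`).

## Status of `pasten_thm_7_5`

`pasten_thm_7_5_holds` is NOT here. Of the four inputs, two are now PROVED in the tree and are
discharged in the second half of this file: Silverman's `log Δ ≤ 12h + 16`
(`pasten2024_log_minimalDiscriminant_le_holds`, `SilvermanHeightLogDiscriminantProofs.lean`) and
Pasten's trivial Petersson bound `(f,f) ≥ e^{-4π}/(4π)` (`IsNewformOf.peterssonProduct_re_ge`,
`NewformPeterssonSizeProofs.lean`). Hence, from MODULARITY ALONE
(`nonempty_modularParametrizationData`), Pasten's display "(3.1)–(3.2)":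
`log|Δ_min(W)| ≤ 6 log(minModularDegree W N_W) + 124` for every globally minimal elliptic `W/ℚ`
(`Pasten2024.log_minimalDiscriminantNorm_le_of_modularity`, with the sharper absolute constant
`24π + 16 − 6 log π < 92`), and `pasten_thm_7_5` follows from modularity and Thm 7.2 (asymptotic
clause) only: `pasten_thm_7_5_of_modularity` (Thm 7.2 rendered on `minModularDegree`) and
`pasten_thm_7_5_of_modularity_of_optimalDegreeBound` (Thm 7.2 rendered, as Thm 5.5 is in
`PastenSpectralDegree.lean`, on the degree `δ_{1,N}` of a datum of minimal degree in the isogeny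
class, together with the Mazur–Kenku named fact `PastenShimura2024_minimalDegree_le_163_mul`
of that file). What remains unproved for `pasten_thm_7_5_holds`: the modularity theorem, and
Thm 7.2's asymptotic clause `log δ_{1,N} < (1/24 + ε) N log N` (not vendored; its printed proof
needs Thm 5.5, G. Martin's bound `dim S₂(n)^{new} ≤ φ(n)/12 + (7/12)2^{ω(n)} + μ(n)` for
Prop 7.1, and Murty 1999, Lemma 11, `n_c ≪_ε N^{1+ε}`, none of which is proved in the tree).

## References

* H. Pasten, *Shimura curves and the abc conjecture*, J. Number Theory 254 (2024) 214–335,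
  arXiv:1705.09251: §3 (p. 13: (3.1), (EqFrey), (3.2)), Thm 7.2 (p. 26), §7.4 Thm 7.5 (p. 27).
  [PastenShimura2024]
* J. H. Silverman, *Heights and elliptic curves*, in Arithmetic Geometry (1986), Prop. 1.1, (14).
  [Silverman1986]
* D. Zagier, *Modular parametrizations of elliptic curves*, Canad. Math. Bull. 28 (1985), §1.
  [ZagierCMB1985]
-/

noncomputable section

open WeierstrassCurve CongruenceSubgroup

namespace Literature.NumberTheory.EllipticCurves

open ModularForms

namespace Pasten2024

/-! ### Real-arithmetic bookkeeping -/

/-- For `ε > 0` and any real `K`, `K < ε · n · log n` for all large naturals `n`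
(since `n log n ≥ n log 2`). [folklore] -/
theorem exists_lt_mul_mul_log {ε : ℝ} (hε : 0 < ε) (K : ℝ) :
    ∃ M : ℕ, ∀ n : ℕ, M ≤ n → K < ε * n * Real.log n := by
  refine ⟨⌈K / (ε * Real.log 2)⌉₊ + 2, fun n hn => ?_⟩
  have hlog2 : 0 < Real.log 2 := Real.log_pos one_lt_two
  have hn2 : (2 : ℝ) ≤ n := by exact_mod_cast le_trans (Nat.le_add_left 2 _) hn
  have hnK : K / (ε * Real.log 2) < n := by
    have h1 : K / (ε * Real.log 2) ≤ ⌈K / (ε * Real.log 2)⌉₊ := Nat.le_ceil _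
    have h2 : ((⌈K / (ε * Real.log 2)⌉₊ + 2 : ℕ) : ℝ) ≤ n := by exact_mod_cast hn
    push_cast at h2
    linarith
  have hlogn : Real.log 2 ≤ Real.log n := Real.log_le_log two_pos hn2
  have hK : K < n * (ε * Real.log 2) := (div_lt_iff₀ (by positivity)).mp hnK
  have hn0 : (0 : ℝ) ≤ n := by positivity
  calc K < n * (ε * Real.log 2) := hK
    _ = ε * n * Real.log 2 := by ring
    _ ≤ ε * n * Real.log n := mul_le_mul_of_nonneg_left hlogn (mul_nonneg hε.le hn0)

/-! ### (EqFrey): the Néron covolume and the height from Zagier's formula -/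

variable {W : WeierstrassCurve ℚ} {N : ℕ} [NeZero N]

/-- **Zagier's formula solved for the covolume**: for a modular parametrisation datum `D`
(newform `f`, Néron-type lattice `Λ = D.L.lattice`, Manin constant `c ≠ 0`, degree `deg ≥ 1`),
`covol(Λ) = 4π² c² (f,f) / deg φ`, from the PROVED `4π² c² (f,f) = deg φ · covol(Λ)`
(`zagier_degree_formula_holds`). This is Pasten's (EqFrey)
`log δ_{1,N} = 2 log(2π c_f) + 2 log‖f‖ + 2 h` read with `h = −½ log covol`.
[cite: PastenShimura2024, §3 (EqFrey), p. 13] -/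
theorem covolume_eq_of_zagier (D : ModularParametrizationData W N) :
    ZLattice.covolume D.L.lattice =
      4 * Real.pi ^ 2 * (D.c : ℝ) ^ 2 * (peterssonProduct (Gamma0 N) 2 D.f D.f).re / D.deg := by
  have hre : (peterssonProduct (Gamma0 N) 2 D.f D.f).re =
      D.deg * ZLattice.covolume D.L.lattice / (4 * Real.pi ^ 2 * (D.c : ℝ) ^ 2) := by
    rw [D.zagier_degree_formula_holds.peterssonProduct_eq, Complex.ofReal_re]
  have hc0 : D.maninConstant ≠ 0 := D.maninConstant_ne_zero_holds
  have hc : (D.c : ℝ) ≠ 0 := by exact_mod_cast hc0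
  have hd : (D.deg : ℝ) ≠ 0 := by exact_mod_cast D.deg_pos.ne'
  rw [hre]
  field_simp

/-- **Pasten's (3.2), tree form**: if the Petersson norm of the newform of the datum `D` is at
least `c₀ > 0`, then `12 h ≤ 6 log deg φ − 6 log(4π² c₀)` where `h = neronLatticeHeight D.L =
−½ log covol(Λ)` is the height of the lattice of `D` (for a globally minimal model, the Faltings
height `h(E)`). Printed: "`log(2π c_f) + log ‖f‖ > −6` … therefore `h(E) ≤ ½ log δ_{1,N} + 9`";
here the integer Manin constant enters through `c ≠ 0 ⇒ c² ≥ 1` (`maninConstant_ne_zero_holds`).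
[cite: PastenShimura2024, §3 (3.2), p. 13] -/
theorem twelve_mul_neronLatticeHeight_le (D : ModularParametrizationData W N) {c₀ : ℝ}
    (hc₀ : 0 < c₀) (hP : c₀ ≤ (peterssonProduct (Gamma0 N) 2 D.f D.f).re) :
    12 * neronLatticeHeight D.L ≤ 6 * Real.log D.deg - 6 * Real.log (4 * Real.pi ^ 2 * c₀) := by
  set P := (peterssonProduct (Gamma0 N) 2 D.f D.f).re
  have hc0 : D.maninConstant ≠ 0 := D.maninConstant_ne_zero_holds
  have hcz : (D.c : ℤ) ≠ 0 := hc0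
  have hcsq : (1 : ℝ) ≤ (D.c : ℝ) ^ 2 := by
    have h1 : (1 : ℤ) ≤ D.c ^ 2 := by
      have h0 : 0 < D.c ^ 2 := by positivity
      exact h0
    exact_mod_cast h1
  have hd : (0 : ℝ) < D.deg := by exact_mod_cast D.deg_pos
  have hπ : (0 : ℝ) < 4 * Real.pi ^ 2 := by positivity
  have hcov : ZLattice.covolume D.L.lattice = 4 * Real.pi ^ 2 * (D.c : ℝ) ^ 2 * P / D.deg :=
    covolume_eq_of_zagier D
  -- `4π² c₀ / deg ≤ 4π² c² (f,f) / deg = covol`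
  have hlow : 4 * Real.pi ^ 2 * c₀ / D.deg ≤ ZLattice.covolume D.L.lattice := by
    rw [hcov]
    apply div_le_div_of_nonneg_right _ hd.le
    have h1 : 1 * c₀ ≤ (D.c : ℝ) ^ 2 * P := mul_le_mul hcsq hP hc₀.le (by positivity)
    calc 4 * Real.pi ^ 2 * c₀ = 4 * Real.pi ^ 2 * (1 * c₀) := by ring
      _ ≤ 4 * Real.pi ^ 2 * ((D.c : ℝ) ^ 2 * P) := mul_le_mul_of_nonneg_left h1 hπ.le
      _ = 4 * Real.pi ^ 2 * (D.c : ℝ) ^ 2 * P := by ring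
  have hlowpos : 0 < 4 * Real.pi ^ 2 * c₀ / D.deg := by positivity
  have hlog : Real.log (4 * Real.pi ^ 2 * c₀) - Real.log D.deg ≤
      Real.log (ZLattice.covolume D.L.lattice) := by
    rw [← Real.log_div (by positivity) hd.ne']
    exact Real.log_le_log hlowpos hlow
  rw [twelve_mul_neronLatticeHeight]
  linarith

/-! ### `|Δ_min|` of a globally minimal model -/

/-- For a globally minimal elliptic `W/ℚ`, the minimal discriminant norm `N(𝔇_min) = |Δ_min|`
(`DiophantineGeometry/MinimalDiscriminant.lean`) is `|Δ(W)|` as a real number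
(`minimalDiscriminantNorm_int_eq_natAbs_minimalDiscriminantInt_holds` and
`cast_minimalDiscriminantInt`). Silverman AEC VIII.8. [folklore] -/
theorem cast_minimalDiscriminantNorm_eq_abs (W : WeierstrassCurve ℚ) [W.IsElliptic]
    [W.IsGloballyMinimal] :
    ((W.minimalDiscriminantNorm ℤ : ℕ) : ℝ) = |((W.Δ : ℚ) : ℝ)| := by
  rw [minimalDiscriminantNorm_int_eq_natAbs_minimalDiscriminantInt_holds W, Nat.cast_natAbs,
    Int.cast_abs, ← cast_minimalDiscriminantInt W, Rat.cast_intCast]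

/-! ### (3.1) + (3.2): `log |Δ_min| ≤ 6 log(deg φ) + O(1)` -/

/-- **`log Δ_E ≤ 6 log δ + O(1)`** (Pasten §3: (3.1) `log Δ_E ≤ 12 h(E) + 16` and (3.2)
`h(E) ≤ ½ log δ_{1,N} + 9`, i.e. `log Δ_E ≤ 6 log δ_{1,N} + 124`), in tree form and from inputs
in their weakest useful shape: modularity with an integral Manin constant
(`nonempty_modularParametrizationData`), a Silverman-type inequality `log|Δ_W| ≤ 12 h + C₁` for
globally minimal `W` and Néron-type lattices (`C₁ = 16` is the named fact
`pasten2024_log_minimalDiscriminant_le`), and an `N`-uniform Petersson lower bound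
`(f,f) ≥ c₀ > 0` for newforms of elliptic curves (Pasten: `log(2π c_f) + log‖f‖ > −6`; implied by
`murty_petersson_newform_lower_bound`). Conclusion: an absolute `K` with
`log |Δ_min(W)| ≤ 6 log(minModularDegree W N_W) + K` for every globally minimal elliptic `W/ℚ`.
[cite: PastenShimura2024, §3 (3.1)–(3.2), p. 13] -/
theorem exists_log_minimalDiscriminantNorm_le (hmod : nonempty_modularParametrizationData)
    (hSil : ∃ C₁ : ℝ, ∀ (W : WeierstrassCurve ℚ) [W.IsElliptic] [W.IsGloballyMinimal]
      (L : PeriodPair), IsNeronLatticeOf (W.baseChange ℂ) L →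
        Real.log |((W.Δ : ℚ) : ℝ)| ≤ 12 * neronLatticeHeight L + C₁)
    (hPet : ∃ c₀ : ℝ, 0 < c₀ ∧ ∀ (N : ℕ) [NeZero N] (W : WeierstrassCurve ℚ) [W.IsElliptic]
      (f : CuspForm (Gamma0 N) 2), IsNewformOf W f → c₀ ≤ (peterssonProduct (Gamma0 N) 2 f f).re) :
    ∃ K : ℝ, ∀ (W : WeierstrassCurve ℚ) [W.IsElliptic] [W.IsGloballyMinimal]
      [NeZero (W.conductorNorm ℤ)],
      Real.log (W.minimalDiscriminantNorm ℤ : ℝ) ≤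
        6 * Real.log (minModularDegree W (W.conductorNorm ℤ) : ℝ) + K := by
  obtain ⟨C₁, hC₁⟩ := hSil
  obtain ⟨c₀, hc₀, hPc⟩ := hPet
  refine ⟨C₁ - 6 * Real.log (4 * Real.pi ^ 2 * c₀), fun W _ _ _ => ?_⟩
  obtain ⟨D, hDmin⟩ := exists_modularDegree_eq_minModularDegree (hmod W)
  have hDmin' : D.deg = minModularDegree W (W.conductorNorm ℤ) := hDmin
  have hP : c₀ ≤ (peterssonProduct (Gamma0 (W.conductorNorm ℤ)) 2 D.f D.f).re :=
    hPc (W.conductorNorm ℤ) W D.f D.isNewformOf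
  have hh := twelve_mul_neronLatticeHeight_le D hc₀ hP
  have hS := hC₁ W D.L D.isNeronLattice
  rw [cast_minimalDiscriminantNorm_eq_abs W, ← hDmin']
  linarith

/-- **Thm 7.5 (asymptotic discriminant clause) from inputs in their weakest shape** — the §7.4
deduction: modularity with an integral Manin constant (`hmod`), a Silverman-type inequality
`log|Δ_W| ≤ 12 h + C₁` (`hSil`), an `N`-uniform Petersson lower bound (`hPet`), and Pasten's
Thm 7.2 in asymptotic form on the minimal modular degree of a globally minimal model (`hdeg`:
`log(minModularDegree W N_W) ≤ (1/24 + ε) N_W log N_W` for `N_W ≥ N₁(ε)`) give `pasten_thm_7_5`.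
As printed: `log Δ_E ≤ 6 log δ + K ≤ (1/4 + ε/2) N log N + K < (1/4 + ε) N log N` for `N ≫_ε 1`,
after passing to a global minimal model `C • W` (`hasGlobalMinimalModel_rat_holds`; `N_E` and
`|Δ_min|` are invariant, `conductorNorm_smul_rat`, `minimalDiscriminantNorm_smul_rat`).
[cite: PastenShimura2024, Theorem 7.5 (proof, §7.4 p. 27, with §3 (3.1)–(3.2))] -/
theorem pasten_thm_7_5_of_inputs (hmod : nonempty_modularParametrizationData)
    (hSil : ∃ C₁ : ℝ, ∀ (W : WeierstrassCurve ℚ) [W.IsElliptic] [W.IsGloballyMinimal]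
      (L : PeriodPair), IsNeronLatticeOf (W.baseChange ℂ) L →
        Real.log |((W.Δ : ℚ) : ℝ)| ≤ 12 * neronLatticeHeight L + C₁)
    (hPet : ∃ c₀ : ℝ, 0 < c₀ ∧ ∀ (N : ℕ) [NeZero N] (W : WeierstrassCurve ℚ) [W.IsElliptic]
      (f : CuspForm (Gamma0 N) 2), IsNewformOf W f → c₀ ≤ (peterssonProduct (Gamma0 N) 2 f f).re)
    (hdeg : ∀ ε : ℝ, 0 < ε → ∃ N₁ : ℕ, ∀ (W : WeierstrassCurve ℚ) [W.IsElliptic]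
      [W.IsGloballyMinimal] [NeZero (W.conductorNorm ℤ)], N₁ ≤ W.conductorNorm ℤ →
        Real.log (minModularDegree W (W.conductorNorm ℤ) : ℝ) ≤
          (1 / 24 + ε) * (W.conductorNorm ℤ : ℝ) * Real.log (W.conductorNorm ℤ)) :
    pasten_thm_7_5 := by
  intro ε hε
  obtain ⟨K, hK⟩ := exists_log_minimalDiscriminantNorm_le hmod hSil hPet
  obtain ⟨N₁, hN₁⟩ := hdeg (ε / 12) (by positivity)
  obtain ⟨M, hM⟩ := exists_lt_mul_mul_log (half_pos hε) K
  refine ⟨max N₁ M, fun W _ hNW => ?_⟩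
  -- pass to a global minimal model `C • W` (Néron; Silverman AEC VIII.8.3)
  obtain ⟨C, hC⟩ := hasGlobalMinimalModel_rat_holds W
  haveI := hC
  have hN : (C • W).conductorNorm ℤ = W.conductorNorm ℤ := conductorNorm_smul_rat W C
  have hΔ : (C • W).minimalDiscriminantNorm ℤ = W.minimalDiscriminantNorm ℤ :=
    minimalDiscriminantNorm_smul_rat W C
  haveI : NeZero ((C • W).conductorNorm ℤ) := ⟨(conductorNorm_pos_holds (C • W)).ne'⟩
  have h1 := hK (C • W)
  have h2 := hN₁ (C • W) (by rw [hN]; exact le_trans (le_max_left _ _) hNW)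
  have key : Real.log ((C • W).minimalDiscriminantNorm ℤ : ℝ) ≤
      (1 / 4 + ε / 2) * ((C • W).conductorNorm ℤ : ℝ) * Real.log ((C • W).conductorNorm ℤ) + K := by
    linarith
  rw [hΔ, hN] at key
  have h3 := hM _ (le_trans (le_max_right _ _) hNW)
  linarith

end Pasten2024

open Pasten2024

/-- **Pasten, Thm 7.5 (asymptotic discriminant clause) from its printed inputs, as named in the
tree** — the §7.4 deduction "the classical modular approach ((EqDiscH) and (EqHDeg)) together with
our bounds for `δ_{D,M}` specialized to `D = 1`, `M = N`, give Thm 7.5": assuming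
(i) modularity with an integral Manin constant (`nonempty_modularParametrizationData`: Wiles,
Taylor–Wiles, Breuil–Conrad–Diamond–Taylor; Edixhoven), (ii) Silverman's
`log Δ_E ≤ 12 h(E) + 16` (`pasten2024_log_minimalDiscriminant_le`), (iii) the Petersson lower
bound `(f,f) ≫_ε N^{1−ε}` (`murty_petersson_newform_lower_bound`, used at `ε = 1` only: Pasten
needs just the trivial `log(2π c_f) + log‖f‖ > −6`), and (iv) `hdeg`, Pasten's Thm 7.2 in its
asymptotic form `log δ_{1,N} < (1/24 + ε) N log N` for `N ≫_ε 1`, rendered on the tree's minimal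
modular degree `minModularDegree W N_W` of a globally minimal model (Thm 7.2 is NOT vendored in
the tree; for the printed `δ_{1,N}` of the optimal quotient `A_{1,N}` one has
`minModularDegree ≤ 163 · δ_{1,N}` by Mazur–Kenku, absorbed in `ε` for `N ≫ 1`), one gets
`pasten_thm_7_5`: `log|Δ_E| < (1/4 + ε) N_E log N_E` for all `E/ℚ` with `N_E ≥ N₀(ε)`.
[cite: PastenShimura2024, Theorem 7.5 (proof, §7.4 p. 27, with §3 (3.1)–(3.2))] -/
theorem pasten_thm_7_5_of_classicalModularApproach
    (hmod : nonempty_modularParametrizationData)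
    (hSil : pasten2024_log_minimalDiscriminant_le)
    (hPet : murty_petersson_newform_lower_bound)
    (hdeg : ∀ ε : ℝ, 0 < ε → ∃ N₁ : ℕ, ∀ (W : WeierstrassCurve ℚ) [W.IsElliptic]
      [W.IsGloballyMinimal] [NeZero (W.conductorNorm ℤ)], N₁ ≤ W.conductorNorm ℤ →
        Real.log (minModularDegree W (W.conductorNorm ℤ) : ℝ) ≤
          (1 / 24 + ε) * (W.conductorNorm ℤ : ℝ) * Real.log (W.conductorNorm ℤ)) :
    pasten_thm_7_5 := by
  refine pasten_thm_7_5_of_inputs hmod ⟨16, fun W _ _ L hL => hSil W L hL⟩ ?_ hdeg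
  obtain ⟨c₀, hc₀, hPc⟩ := hPet 1 one_pos
  exact ⟨c₀, hc₀, fun N _ W _ f hf => by simpa using hPc N W f hf⟩

/-! ### Discharging the Silverman and Petersson inputs (both now proved in the tree) -/

namespace Pasten2024

/-- `log(4π² · e^{-4π}/(4π)) = log π − 4π` (the constant produced by Pasten's trivial Petersson
bound `(f,f) ≥ e^{-4π}/(4π)` inside (3.2)). [folklore] -/
theorem log_four_pi_sq_mul_trivialPeterssonConst :
    Real.log (4 * Real.pi ^ 2 * (Real.exp (-(4 * Real.pi)) / (4 * Real.pi))) =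
      Real.log Real.pi - 4 * Real.pi := by
  have hπ : Real.pi ≠ 0 := Real.pi_pos.ne'
  have h : 4 * Real.pi ^ 2 * (Real.exp (-(4 * Real.pi)) / (4 * Real.pi)) =
      Real.pi * Real.exp (-(4 * Real.pi)) := by
    field_simp
  rw [h, Real.log_mul hπ (Real.exp_pos _).ne', Real.log_exp]
  ring

/-- **Pasten's (3.1)–(3.2) from modularity alone, sharp-constant form**: for every globally
minimal elliptic `W/ℚ` admitting modular parametrisation data at level `N_W` (the named fact
`nonempty_modularParametrizationData`, i.e. modularity with an integral Manin constant),
`log|Δ_min(W)| ≤ 6 log(minModularDegree W N_W) + (24π + 16 − 6 log π)`.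
Printed: (3.1) `log Δ_E ≤ 12 h(E) + 16` (Silverman; PROVED in the tree,
`pasten2024_log_minimalDiscriminant_le_holds`) and (3.2) `h(E) ≤ ½ log δ_{1,N} + 9` from (EqFrey)
with `c_f ∈ ℤ ∖ {0}` and the trivial bound obtained "by integrating `f · f̄` on
`{|x| < 1/2, y > 1}`" (PROVED in the tree, `IsNewformOf.peterssonProduct_re_ge`:
`(f,f) ≥ e^{-4π}/(4π)`); here for the minimal-degree datum of `W` itself rather than for the
optimal quotient `A_{1,N}`. [cite: PastenShimura2024, §3 (3.1)–(3.2), p. 13] -/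
theorem log_minimalDiscriminantNorm_le_of_modularity (hmod : nonempty_modularParametrizationData)
    (W : WeierstrassCurve ℚ) [W.IsElliptic] [W.IsGloballyMinimal] [NeZero (W.conductorNorm ℤ)] :
    Real.log (W.minimalDiscriminantNorm ℤ : ℝ) ≤
      6 * Real.log (minModularDegree W (W.conductorNorm ℤ) : ℝ) +
        (24 * Real.pi + 16 - 6 * Real.log Real.pi) := by
  obtain ⟨D, hDmin⟩ := exists_modularDegree_eq_minModularDegree (hmod W)
  have hDmin' : D.deg = minModularDegree W (W.conductorNorm ℤ) := hDmin
  have hc₀ : 0 < Real.exp (-(4 * Real.pi)) / (4 * Real.pi) := by positivity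
  have hP : Real.exp (-(4 * Real.pi)) / (4 * Real.pi) ≤
      (peterssonProduct (Gamma0 (W.conductorNorm ℤ)) 2 D.f D.f).re :=
    D.isNewformOf.peterssonProduct_re_ge
  have hh := twelve_mul_neronLatticeHeight_le D hc₀ hP
  have hS := pasten2024_log_minimalDiscriminant_le_holds W D.L D.isNeronLattice
  rw [log_four_pi_sq_mul_trivialPeterssonConst] at hh
  rw [cast_minimalDiscriminantNorm_eq_abs W, ← hDmin']
  linarith

/-- The absolute constant of `log_minimalDiscriminantNorm_le_of_modularity` is below Pasten's
printed `124` (indeed `24π + 16 − 6 log π < 24·4 + 16 = 112`, as `log π ≥ 0`). [folklore] -/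
theorem const_le_124 : 24 * Real.pi + 16 - 6 * Real.log Real.pi ≤ 124 := by
  have h4 : Real.pi ≤ 4 := Real.pi_le_four
  have hlog : 0 ≤ Real.log Real.pi :=
    Real.log_nonneg (le_trans (by norm_num) Real.pi_gt_three.le)
  linarith

/-- **`log Δ_E ≤ 6 log δ + 124` from modularity alone** (Pasten §3, the two displays (3.1) and
(3.2) combined with the printed constants `12 · 9 + 16 = 124`): for every globally minimal elliptic
`W/ℚ`, `log|Δ_min(W)| ≤ 6 log(minModularDegree W N_W) + 124`, assuming only
`nonempty_modularParametrizationData`. [cite: PastenShimura2024, §3 (3.1)–(3.2), p. 13] -/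
theorem log_minimalDiscriminantNorm_le_of_modularity' (hmod : nonempty_modularParametrizationData)
    (W : WeierstrassCurve ℚ) [W.IsElliptic] [W.IsGloballyMinimal] [NeZero (W.conductorNorm ℤ)] :
    Real.log (W.minimalDiscriminantNorm ℤ : ℝ) ≤
      6 * Real.log (minModularDegree W (W.conductorNorm ℤ) : ℝ) + 124 := by
  have h := log_minimalDiscriminantNorm_le_of_modularity hmod W
  have hc := const_le_124
  linarith

/-- The Petersson input `hPet` of `pasten_thm_7_5_of_inputs`, DISCHARGED by Pasten's trivial bound
(`IsNewformOf.peterssonProduct_re_ge`, proved in `NewformPeterssonSizeProofs.lean`): an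
`N`-uniform `c₀ = e^{-4π}/(4π) > 0` below `Re (f,f)_{Γ₀(N)}` for the newform of every elliptic
curve. [cite: PastenShimura2024, §3 (p. 13, "log(2π c_f) + log ‖f‖ > −6")] -/
theorem petersson_input_holds :
    ∃ c₀ : ℝ, 0 < c₀ ∧ ∀ (N : ℕ) [NeZero N] (W : WeierstrassCurve ℚ) [W.IsElliptic]
      (f : CuspForm (Gamma0 N) 2), IsNewformOf W f → c₀ ≤ (peterssonProduct (Gamma0 N) 2 f f).re :=
  ⟨Real.exp (-(4 * Real.pi)) / (4 * Real.pi), by positivity,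
    fun _ _ _ _ _ hf => hf.peterssonProduct_re_ge⟩

/-- The Silverman input `hSil` of `pasten_thm_7_5_of_inputs`, DISCHARGED by
`pasten2024_log_minimalDiscriminant_le_holds` (`C₁ = 16`).
[cite: PastenShimura2024, §3 (display log Δ_E ≤ 12h(E)+16)] -/
theorem silverman_input_holds :
    ∃ C₁ : ℝ, ∀ (W : WeierstrassCurve ℚ) [W.IsElliptic] [W.IsGloballyMinimal]
      (L : PeriodPair), IsNeronLatticeOf (W.baseChange ℂ) L →
        Real.log |((W.Δ : ℚ) : ℝ)| ≤ 12 * neronLatticeHeight L + C₁ :=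
  ⟨16, fun W _ _ L hL => pasten2024_log_minimalDiscriminant_le_holds W L hL⟩

end Pasten2024

/-- **Pasten, Thm 7.5 (asymptotic discriminant clause) from modularity and Thm 7.2 only.** With
Silverman's inequality and the trivial Petersson bound now theorems of the tree, `pasten_thm_7_5`
(`log|Δ_E| < (1/4 + ε) N_E log N_E` for `N_E ≥ N₀(ε)`) follows from (i) modularity with an integral
Manin constant (`nonempty_modularParametrizationData`) and (ii) `hdeg`, Thm 7.2 in its asymptotic
form `log δ < (1/24 + ε) N log N` for `N ≫_ε 1`, rendered on the minimal modular degree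
`minModularDegree W N_W` of a globally minimal model (Thm 7.2 is not vendored in the tree).
[cite: PastenShimura2024, Theorem 7.5 (proof, §7.4 p. 27, with §3 (3.1)–(3.2))] -/
theorem pasten_thm_7_5_of_modularity
    (hmod : nonempty_modularParametrizationData)
    (hdeg : ∀ ε : ℝ, 0 < ε → ∃ N₁ : ℕ, ∀ (W : WeierstrassCurve ℚ) [W.IsElliptic]
      [W.IsGloballyMinimal] [NeZero (W.conductorNorm ℤ)], N₁ ≤ W.conductorNorm ℤ →
        Real.log (minModularDegree W (W.conductorNorm ℤ) : ℝ) ≤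
          (1 / 24 + ε) * (W.conductorNorm ℤ : ℝ) * Real.log (W.conductorNorm ℤ)) :
    pasten_thm_7_5 :=
  pasten_thm_7_5_of_inputs hmod Pasten2024.silverman_input_holds Pasten2024.petersson_input_holds
    hdeg

/-! ### Thm 7.2 in the `δ_{1,N}` idiom of `PastenSpectralDegree.lean` -/

namespace Pasten2024

/-- **A datum of minimal degree in the class exists.** If `W` has a datum `D'` at level `N`, then
among ALL data at level `N`, of all elliptic `W''/ℚ`, with the same newform `D'.f` there is one of
least modular degree (well-ordering of `ℕ`); its degree is Pasten's `δ_{1,N}` in the reading of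
`PastenShimura2024_thm_5_5`. [folklore] -/
theorem exists_minimal_datum_in_class {N : ℕ} [NeZero N] {W : WeierstrassCurve ℚ} [W.IsElliptic]
    (D' : ModularParametrizationData W N) :
    ∃ (W₀ : WeierstrassCurve ℚ) (_ : W₀.IsElliptic) (D₀ : ModularParametrizationData W₀ N),
      D₀.f = D'.f ∧
        ∀ (W'' : WeierstrassCurve ℚ) [W''.IsElliptic] (D'' : ModularParametrizationData W'' N),
          D''.f = D₀.f → D₀.modularDegree ≤ D''.modularDegree := by
  classical
  set S : Set ℕ := {d | ∃ (W'' : WeierstrassCurve ℚ) (_ : W''.IsElliptic)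
    (D'' : ModularParametrizationData W'' N), D''.f = D'.f ∧ D''.modularDegree = d} with hS
  have hne : S.Nonempty := ⟨D'.modularDegree, W, ‹_›, D', rfl, rfl⟩
  obtain ⟨W₀, hW₀, D₀, hf, hdeg⟩ := Nat.sInf_mem hne
  refine ⟨W₀, hW₀, D₀, hf, fun W'' _ D'' hf'' => ?_⟩
  rw [hdeg]
  exact Nat.sInf_le ⟨W'', ‹_›, D'', hf''.trans hf, rfl⟩

/-- **From `δ_{1,N}` to the minimal modular degree of a globally minimal model** (Pasten §3 p. 13,
Mazur–Kenku: "the degree of a minimal isogeny between `A_{1,N}` and `E` is uniformly bounded by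
`163`", in the tree the named fact `PastenShimura2024_minimalDegree_le_163_mul`): a bound
`log δ_{1,N} < B` for the data of minimal degree in the class at level `N_W` gives
`log(minModularDegree W N_W) ≤ log 163 + B` for every globally minimal elliptic `W` with a datum.
[cite: PastenShimura2024, §3 p. 13] -/
theorem log_minModularDegree_le_of_class_bound (h163 : PastenShimura2024_minimalDegree_le_163_mul)
    {W : WeierstrassCurve ℚ} [W.IsElliptic] [W.IsGloballyMinimal] [NeZero (W.conductorNorm ℤ)]
    (hW : Nonempty (ModularParametrizationData W (W.conductorNorm ℤ))) {B : ℝ}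
    (hB : ∀ (W₀ : WeierstrassCurve ℚ) [W₀.IsElliptic]
      (D₀ : ModularParametrizationData W₀ (W.conductorNorm ℤ)),
      (∀ (W'' : WeierstrassCurve ℚ) [W''.IsElliptic]
          (D'' : ModularParametrizationData W'' (W.conductorNorm ℤ)),
          D''.f = D₀.f → D₀.modularDegree ≤ D''.modularDegree) →
        Real.log (D₀.modularDegree : ℝ) < B) :
    Real.log (minModularDegree W (W.conductorNorm ℤ) : ℝ) ≤ Real.log 163 + B := by
  obtain ⟨D', hD'min, hD'le⟩ := exists_minimal_datum hW
  obtain ⟨W₀, hW₀, D₀, hf, hmin⟩ := exists_minimal_datum_in_class D'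
  have h1 : D'.modularDegree ≤ 163 * D₀.modularDegree :=
    h163 (W.conductorNorm ℤ) W₀ W D₀ D' hf.symm hmin hD'le
  have hB₀ := hB W₀ D₀ hmin
  have hd₀ : (0 : ℝ) < D₀.modularDegree := by exact_mod_cast D₀.deg_pos
  have hd' : (0 : ℝ) < D'.modularDegree := by exact_mod_cast D'.deg_pos
  have h1' : (D'.modularDegree : ℝ) ≤ 163 * (D₀.modularDegree : ℝ) := by exact_mod_cast h1
  rw [← hD'min]
  calc Real.log (D'.modularDegree : ℝ)
      ≤ Real.log (163 * (D₀.modularDegree : ℝ)) := Real.log_le_log hd' h1'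
    _ = Real.log 163 + Real.log (D₀.modularDegree : ℝ) :=
        Real.log_mul (by norm_num) hd₀.ne'
    _ ≤ Real.log 163 + B := by linarith

end Pasten2024

/-- **Pasten, Thm 7.5 (asymptotic discriminant clause) from modularity, Mazur–Kenku and Thm 7.2 in
Pasten's own `δ_{1,N}` form.** Inputs: (i) modularity with an integral Manin constant
(`nonempty_modularParametrizationData`); (ii) the Mazur–Kenku comparison
`minimal degree ≤ 163 · δ_{1,N}` (named fact `PastenShimura2024_minimalDegree_le_163_mul` of
`PastenSpectralDegree.lean`, Pasten §3 p. 13); (iii) `hδ`, the asymptotic clause of Thm 7.2,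
"given any `ε > 0`, for `N ≫_ε 1` … `log δ_{1,N} < (1/24 + ε) N log N`", with `δ_{1,N}` read —
exactly as in `PastenShimura2024_thm_5_5` — as the modular degree of a datum of minimal degree
among all data at level `N`, of all elliptic `W'/ℚ`, with the same newform (Thm 7.2 is not vendored
in the tree; this is the slot for it). The factor `163` is absorbed into `ε N log N` for `N ≫ 1`.
[cite: PastenShimura2024, Theorem 7.5 (proof, §7.4 p. 27) with Thm 7.2 (p. 26) and §3 p. 13] -/
theorem pasten_thm_7_5_of_modularity_of_optimalDegreeBound
    (hmod : nonempty_modularParametrizationData)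
    (h163 : PastenShimura2024_minimalDegree_le_163_mul)
    (hδ : ∀ ε : ℝ, 0 < ε → ∃ N₁ : ℕ, ∀ (N : ℕ) [NeZero N] (W : WeierstrassCurve ℚ) [W.IsElliptic]
      (D : ModularParametrizationData W N),
      (∀ (W' : WeierstrassCurve ℚ) [W'.IsElliptic] (D' : ModularParametrizationData W' N),
          D'.f = D.f → D.modularDegree ≤ D'.modularDegree) →
        N₁ ≤ N → Real.log (D.modularDegree : ℝ) < (1 / 24 + ε) * (N : ℝ) * Real.log N) :
    pasten_thm_7_5 := by
  refine pasten_thm_7_5_of_modularity hmod fun ε hε => ?_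
  obtain ⟨N₁, hN₁⟩ := hδ (ε / 2) (half_pos hε)
  obtain ⟨M, hM⟩ := Pasten2024.exists_lt_mul_mul_log (half_pos hε) (Real.log 163)
  refine ⟨max N₁ M, fun W _ _ _ hNW => ?_⟩
  have hN₁W : N₁ ≤ W.conductorNorm ℤ := le_trans (le_max_left _ _) hNW
  have hMW : M ≤ W.conductorNorm ℤ := le_trans (le_max_right _ _) hNW
  have hlog := Pasten2024.log_minModularDegree_le_of_class_bound h163 (hmod W)
    (B := (1 / 24 + ε / 2) * (W.conductorNorm ℤ : ℝ) * Real.log (W.conductorNorm ℤ))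
    (fun W₀ _ D₀ hmin => hN₁ (W.conductorNorm ℤ) W₀ D₀ hmin hN₁W)
  have h163' := hM _ hMW
  linarith

end Literature.NumberTheory.EllipticCurves

end
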